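import Mathlib
import HarnessLib
import Literature.MathematicalPhysics.QuantumFieldTheory.OSReconstructionNoE1
import Summits.QuantumFields.YangMills.Theorems.PencilRigidityKernelTransferApprox

/-!
# `CurvatureKernelBound` — stub B support: OS positivity and contraction at kernel level

Support file for crux `stmt-QuantumFields-11687` (`PencilRigidity.CurvatureKernelBound`), line
`sixteen-charts-analytic-kernel`, stub `AxisEnvelope` (B).

Let `𝔖` be a one-species family on `ℝ⁴` with E2 (finite-list reflection positivity along `e₀`) and
translation invariance on `⁰𝒮`, and let `K : ℝ⁴ → ℂ` (continuous off `0`) represent `𝔖₂` on `⁰𝒮`.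
With `h : OSReconstructionNoE1 𝔖.toLabelled` (GNS space, contraction semigroup `e^{-tH}`):

* `norm_integral_mul_sub_le`: complex concentration estimate for a probability weight;
* `norm_osPair_sub_le`: `𝔖₂(θφ_a* ⊗ φ_b)` on two normalised bumps of radius `r` at `a, b`
  (positive times) is within `δ` of `K(θa - b)` once `K` varies by `≤ δ` on `B(θa - b, 2r)`
  (complex re-typing of `KernelTransfer.osPair_twoPoint`);
* `gram_facts`: `‖Ψ_a‖² = 𝔖₂(θφ_a* ⊗ φ_a)` is real `≥ 0` and
  `|𝔖₂(θφ_a* ⊗ (φ_b)_{τe₀})|² = |⟪Ψ_a, e^{-τH}Ψ_b⟫|² ≤ ‖Ψ_a‖² ‖Ψ_b‖²` (`norm_transfer_le`);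
* `negative_halfspace_control`: for `s > 0`, `K(-s e₀)` is real `≥ 0`, `s ↦ Re K(-s e₀)` is
  non-increasing, and `‖K ξ‖ ≤ Re K(ξ₀ e₀)` whenever `ξ₀ < 0` (bumps shrinking to points).
[folklore]
-/

noncomputable section

open scoped BigOperators Topology SchwartzMap ComplexConjugate InnerProductSpace
open MeasureTheory Filter Set
open Literature.MathematicalPhysics.QuantumLattice Literature.MathematicalPhysics.AQFT
open Literature.MathematicalPhysics.QuantumFieldTheory
open Literature.MathematicalPhysics.QuantumLattice.SchwingerFamily (timeVec)
open Summit.QuantumFields.YangMills.Theorems.KernelTransfer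

namespace Summit.QuantumFields.YangMills.Theorems.CurvatureKernel

/-! ## Concentration -/

/-- **Concentration estimate (complex values).** If `ψ ≥ 0` has total mass `1` and is supported
in a set `S` on which `‖W - w₀‖ ≤ δ`, then `‖∫ W ψ - w₀‖ ≤ δ` (for `W ψ` integrable). [folklore] -/
theorem norm_integral_mul_sub_le {α : Type*} [MeasurableSpace α] {μ : Measure α}
    {ψ : α → ℝ} {W : α → ℂ} {w₀ : ℂ} {δ : ℝ} {S : Set α}
    (hψ0 : ∀ v, 0 ≤ ψ v) (hψ1 : ∫ v, ψ v ∂μ = 1) (hsupp : ∀ v, ψ v ≠ 0 → v ∈ S)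
    (hW : ∀ v ∈ S, ‖W v - w₀‖ ≤ δ) (hint : Integrable (fun v => W v * ψ v) μ) :
    ‖(∫ v, W v * ψ v ∂μ) - w₀‖ ≤ δ := by
  have hψint : Integrable ψ μ := by
    by_contra h
    rw [integral_undef h] at hψ1
    exact zero_ne_one hψ1
  have hψintC : Integrable (fun v => (ψ v : ℂ)) μ := hψint.ofReal
  have hψ1C : ∫ v, (ψ v : ℂ) ∂μ = 1 := by
    rw [integral_complex_ofReal, hψ1]; simp
  have hsub : (∫ v, W v * ψ v ∂μ) - w₀ = ∫ v, (W v - w₀) * ψ v ∂μ := by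
    have h1 : ∫ v, (W v - w₀) * ψ v ∂μ = (∫ v, W v * ψ v ∂μ) - ∫ v, w₀ * ψ v ∂μ := by
      rw [← integral_sub hint (hψintC.const_mul w₀)]
      refine integral_congr_ae (Eventually.of_forall fun v => ?_)
      ring
    rw [h1, integral_const_mul, hψ1C, mul_one]
  rw [hsub]
  have hbound : ∀ v, ‖(W v - w₀) * ψ v‖ ≤ δ * ψ v := by
    intro v
    by_cases hv : ψ v = 0
    · simp [hv]
    · rw [norm_mul, Complex.norm_real, Real.norm_eq_abs, abs_of_nonneg (hψ0 v)]
      exact mul_le_mul_of_nonneg_right (hW v (hsupp v hv)) (hψ0 v)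
  have h := norm_integral_le_of_norm_le (hψint.const_mul δ) (Eventually.of_forall hbound)
  rw [integral_const_mul, hψ1, mul_one] at h
  exact h

/-! ## The two-point function on a concentrated pair of bumps (complex kernel) -/

/-- **Two-point function of a concentrated E2 witness (complex kernel).** If
`𝔖₂ = ∫ K(x₀ - x₁)·` on `⁰𝒮` and `H` is the weight `β_a(θ y₀) β_b(y₁)` of two normalised bumps of
radius `r` at points `a, b` of time `> r`, then `𝔖₂(H)` is within `δ` of `K(θa - b)` as soon as
`K` varies by at most `δ` on the ball of radius `2r` around `θa - b`. [folklore] -/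
theorem norm_osPair_sub_le {S : SchwingerFamily (EuclideanSpace ℝ (Fin 4))}
    {K : (EuclideanSpace ℝ (Fin 4)) → ℂ}
    (hrep : ∀ F : 𝓢((Fin 2 → (EuclideanSpace ℝ (Fin 4))), ℂ), IsOffDiagonal F →
      Integrable (fun x : Fin 2 → (EuclideanSpace ℝ (Fin 4)) => K (x 0 - x 1) * F x) ∧
        S 2 F = ∫ x : Fin 2 → (EuclideanSpace ℝ (Fin 4)), K (x 0 - x 1) * F x)
    {βa βb : (EuclideanSpace ℝ (Fin 4)) → ℝ} {a b : (EuclideanSpace ℝ (Fin 4))} {r δ : ℝ}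
    (hra : r < a 0) (hrb : r < b 0)
    (hβa0 : ∀ z, 0 ≤ βa z) (hβb0 : ∀ z, 0 ≤ βb z) (hβa1 : ∫ z, βa z = 1) (hβb1 : ∫ z, βb z = 1)
    (hβa : ∀ z, βa z ≠ 0 → dist z a < r) (hβb : ∀ z, βb z ≠ 0 → dist z b < r)
    (hK : ∀ z, dist z (timeReflection 4 a - b) < r + r →
      ‖K z - K (timeReflection 4 a - b)‖ ≤ δ)
    {H : 𝓢((Fin 2 → (EuclideanSpace ℝ (Fin 4))), ℂ)}
    (hH : ∀ y, H y = ((βa (timeReflection 4 (y 0)) * βb (y 1) : ℝ) : ℂ)) :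
    ‖S 2 H - K (timeReflection 4 a - b)‖ ≤ δ := by
  obtain ⟨hint, hS⟩ := hrep H (isOffDiagonal_osPair hra hrb hβa hβb hH)
  set ψ : (Fin 2 → (EuclideanSpace ℝ (Fin 4))) → ℝ :=
    fun y => βa (timeReflection 4 (y 0)) * βb (y 1) with hψ
  have hfun : (fun y : Fin 2 → (EuclideanSpace ℝ (Fin 4)) => K (y 0 - y 1) * H y) =
      fun y => K (y 0 - y 1) * (ψ y : ℂ) := by
    funext y; rw [hH]
  rw [hfun] at hint hS
  rw [hS]
  refine norm_integral_mul_sub_le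
    (S := {y : Fin 2 → (EuclideanSpace ℝ (Fin 4)) |
      dist (y 0 - y 1) (timeReflection 4 a - b) < r + r})
    (fun y => mul_nonneg (hβa0 _) (hβb0 _)) (integral_osPair hβa1 hβb1) (fun y hy => ?_)
    (fun y hy => hK _ hy) hint
  obtain ⟨h0, h1⟩ := mul_ne_zero_iff.1 hy
  have d0 := hβa _ h0
  have d1 := hβb _ h1
  rw [Set.mem_setOf_eq]
  rw [dist_eq_norm] at d0 d1 ⊢
  have e0 : ‖y 0 - timeReflection 4 a‖ = ‖timeReflection 4 (y 0) - a‖ := by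
    rw [← (timeReflection 4).norm_map (y 0 - timeReflection 4 a), map_sub,
      timeReflection_timeReflection]
  calc ‖y 0 - y 1 - (timeReflection 4 a - b)‖ = ‖(y 0 - timeReflection 4 a) - (y 1 - b)‖ := by
        congr 1; abel
    _ ≤ ‖y 0 - timeReflection 4 a‖ + ‖y 1 - b‖ := norm_sub_le _ _
    _ < r + r := by rw [e0]; exact add_lt_add d0 d1

/-! ## The OS Hilbert space: positivity and the contraction `e^{-τH}` -/

/-- **Gram facts.** For time-ordered one-point test functions `φ_a, φ_b` and `τ ≥ 0`, in the OS
Hilbert space of `𝔖` (E2 + translation invariance on `⁰𝒮`): `𝔖₂(θφ_a* ⊗ φ_a) = ‖Ψ_a‖²` is real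
and non-negative, and `|𝔖₂(θφ_a* ⊗ (φ_b)(· - τe₀))|² = |⟪Ψ_a, e^{-τH} Ψ_b⟫|² ≤ ‖Ψ_a‖² ‖Ψ_b‖²`
(Cauchy–Schwarz and the contraction property `‖e^{-τH}‖ ≤ 1`). [folklore] -/
theorem gram_facts {S : SchwingerFamily (EuclideanSpace ℝ (Fin 4))}
    (h : OSReconstructionNoE1 S.toLabelled)
    {φa φb : 𝓢((Fin 1 → (EuclideanSpace ℝ (Fin 4))), ℂ)} (hφa : IsTimeOrdered φa)
    (hφb : IsTimeOrdered φb) {τ : ℝ} (hτ : 0 ≤ τ) :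
    (S 2 (SchwartzMap.appendTensor (osAdjoint φa) φa)).im = 0 ∧
      0 ≤ (S 2 (SchwartzMap.appendTensor (osAdjoint φa) φa)).re ∧
      ‖S 2 (SchwartzMap.appendTensor (osAdjoint φa) (translateMulti (timeVec τ) φb))‖ ^ 2 ≤
        (S 2 (SchwartzMap.appendTensor (osAdjoint φa) φa)).re *
          (S 2 (SchwartzMap.appendTensor (osAdjoint φb) φb)).re := by
  set Ψa := h.fieldVec 1 (fun _ => ()) φa hφa with hΨa
  set Ψb := h.fieldVec 1 (fun _ => ()) φb hφb with hΨb
  have hA : ⟪Ψa, Ψa⟫_ℂ = S 2 (SchwartzMap.appendTensor (osAdjoint φa) φa) :=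
    h.inner_fieldVec_fieldVec (fun _ => ()) (fun _ => ()) hφa hφa (isAppendTensorOf_appendTensor _ _)
  have hB : ⟪Ψb, Ψb⟫_ℂ = S 2 (SchwartzMap.appendTensor (osAdjoint φb) φb) :=
    h.inner_fieldVec_fieldVec (fun _ => ()) (fun _ => ()) hφb hφb (isAppendTensorOf_appendTensor _ _)
  have hC : ⟪Ψa, h.transfer τ Ψb⟫_ℂ =
      S 2 (SchwartzMap.appendTensor (osAdjoint φa) (translateMulti (timeVec τ) φb)) := by
    rw [hΨb, h.transfer_fieldVec hτ]
    exact h.inner_fieldVec_fieldVec (fun _ => ()) (fun _ => ()) hφa _ (isAppendTensorOf_appendTensor _ _)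
  have hAn : S 2 (SchwartzMap.appendTensor (osAdjoint φa) φa) = ((‖Ψa‖ ^ 2 : ℝ) : ℂ) := by
    rw [← hA, inner_self_eq_norm_sq_to_K]; norm_cast
  have hBn : S 2 (SchwartzMap.appendTensor (osAdjoint φb) φb) = ((‖Ψb‖ ^ 2 : ℝ) : ℂ) := by
    rw [← hB, inner_self_eq_norm_sq_to_K]; norm_cast
  rw [hAn, hBn, ← hC, Complex.ofReal_im, Complex.ofReal_re, Complex.ofReal_re]
  refine ⟨rfl, sq_nonneg _, ?_⟩
  have h1 : ‖⟪Ψa, h.transfer τ Ψb⟫_ℂ‖ ≤ ‖Ψa‖ * ‖Ψb‖ :=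
    (norm_inner_le_norm Ψa _).trans (mul_le_mul_of_nonneg_left (h.norm_transfer_le τ Ψb) (norm_nonneg _))
  calc ‖⟪Ψa, h.transfer τ Ψb⟫_ℂ‖ ^ 2 ≤ (‖Ψa‖ * ‖Ψb‖) ^ 2 :=
        pow_le_pow_left₀ (norm_nonneg _) h1 2
    _ = ‖Ψa‖ ^ 2 * ‖Ψb‖ ^ 2 := by ring

/-! ## Gram data at points: bumps shrinking to `p, q` -/

/-- **Approximate Gram data at two points.** For points `p, q` of positive time, `τ ≥ 0` and
`ε > 0` there are complex numbers `A ≈ K(θp - p)`, `B ≈ K(θq - q)`, `C ≈ K(θp - q - τe₀)`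
(within `ε`) with `A, B` real non-negative and `|C|² ≤ A·B`: the Gram data
`‖Ψ_a‖², ‖Ψ_b‖², ⟪Ψ_a, e^{-τH}Ψ_b⟫` of normalised bumps of small radius at `p` and `q`.
[folklore] -/
theorem exists_gram_approx (S₁ : SchwingerFamily (EuclideanSpace ℝ (Fin 4)))
    (K : (EuclideanSpace ℝ (Fin 4)) → ℂ) (hE2 : S₁.toLabelled.IsReflectionPositive)
    (hT : ∀ (n : ℕ) (a : (EuclideanSpace ℝ (Fin 4))) (F : 𝓢((Fin n → (EuclideanSpace ℝ (Fin 4))), ℂ)),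
      IsOffDiagonal F → S₁ n (translateMulti a F) = S₁ n F)
    (hK : ContinuousOn K {x : (EuclideanSpace ℝ (Fin 4)) | x ≠ 0})
    (hrep : ∀ F : 𝓢((Fin 2 → (EuclideanSpace ℝ (Fin 4))), ℂ), IsOffDiagonal F →
      Integrable (fun x : Fin 2 → (EuclideanSpace ℝ (Fin 4)) => K (x 0 - x 1) * F x) ∧
        S₁ 2 F = ∫ x : Fin 2 → (EuclideanSpace ℝ (Fin 4)), K (x 0 - x 1) * F x)
    (p q : (EuclideanSpace ℝ (Fin 4))) (hp : 0 < p 0) (hq : 0 < q 0) {τ : ℝ} (hτ : 0 ≤ τ)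
    {ε : ℝ} (hε : 0 < ε) :
    ∃ A B C : ℂ, A.im = 0 ∧ 0 ≤ A.re ∧ B.im = 0 ∧ 0 ≤ B.re ∧ ‖C‖ ^ 2 ≤ A.re * B.re ∧
      ‖A - K (timeReflection 4 p - p)‖ ≤ ε ∧ ‖B - K (timeReflection 4 q - q)‖ ≤ ε ∧
      ‖C - K (timeReflection 4 p - (q + (timeVec τ : EuclideanSpace ℝ (Fin 4))))‖ ≤ ε := by
  have h : OSReconstructionNoE1 S₁.toLabelled := ⟨hE2, fun n _ a F hF => hT n a F hF⟩
  set c : (EuclideanSpace ℝ (Fin 4)) := timeVec τ with hc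
  -- the three kernel points and continuity radii there
  set z₁ : (EuclideanSpace ℝ (Fin 4)) := timeReflection 4 p - p with hz₁
  set z₂ : (EuclideanSpace ℝ (Fin 4)) := timeReflection 4 q - q with hz₂
  set z₃ : (EuclideanSpace ℝ (Fin 4)) := timeReflection 4 p - (q + c) with hz₃
  have hc0 : c 0 = τ := OSReconstructionNoE1.timeVec_apply_zero τ
  have hqτ : 0 < (q + c) 0 := by rw [PiLp.add_apply, hc0]; linarith
  have hne : ∀ (a b : (EuclideanSpace ℝ (Fin 4))), 0 < a 0 → 0 < b 0 → timeReflection 4 a - b ≠ 0 := by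
    intro a b ha hb hab
    have h0 : (timeReflection 4 a - b) 0 = (0 : EuclideanSpace ℝ (Fin 4)) 0 := by rw [hab]
    rw [PiLp.sub_apply, timeReflection_apply, if_pos rfl, PiLp.zero_apply] at h0
    linarith
  have hcont : ∀ z : (EuclideanSpace ℝ (Fin 4)), z ≠ 0 →
      ∃ ρ : ℝ, 0 < ρ ∧ ∀ w, dist w z < ρ → ‖K w - K z‖ ≤ ε := by
    intro z hz
    have hca : ContinuousAt K z := (hK z hz).continuousAt (isOpen_compl_singleton.mem_nhds hz)
    obtain ⟨ρ, hρ, hρK⟩ := Metric.continuousAt_iff.1 hca ε hε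
    exact ⟨ρ, hρ, fun w hw => by have := hρK hw; rw [dist_eq_norm] at this; exact this.le⟩
  obtain ⟨ρ₁, hρ₁, hK₁⟩ := hcont z₁ (hne p p hp hp)
  obtain ⟨ρ₂, hρ₂, hK₂⟩ := hcont z₂ (hne q q hq hq)
  obtain ⟨ρ₃, hρ₃, hK₃⟩ := hcont z₃ (hne p _ hp hqτ)
  -- one radius for the bumps
  set m : ℝ := min (min (p 0) (q 0)) (min ρ₁ (min ρ₂ ρ₃)) with hmdef
  have hm : 0 < m := lt_min (lt_min hp hq) (lt_min hρ₁ (lt_min hρ₂ hρ₃))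
  set r : ℝ := m / 4 with hr
  have hr0 : 0 < r := by positivity
  have hrle : ∀ t : ℝ, m ≤ t → r + r < t := by
    intro t ht; rw [hr]; linarith
  have hrp : r < p 0 := by
    linarith [hrle (p 0) ((min_le_left _ _).trans (min_le_left _ _))]
  have hrq : r < q 0 := by
    linarith [hrle (q 0) ((min_le_left _ _).trans (min_le_right _ _))]
  have hrqτ : r < (q + c) 0 := by rw [PiLp.add_apply, hc0]; linarith
  have hr₁ : r + r < ρ₁ := hrle ρ₁ ((min_le_right _ _).trans (min_le_left _ _))
  have hr₂ : r + r < ρ₂ := hrle ρ₂ ((min_le_right _ _).trans ((min_le_right _ _).trans (min_le_left _ _)))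
  have hr₃ : r + r < ρ₃ := hrle ρ₃ ((min_le_right _ _).trans ((min_le_right _ _).trans (min_le_right _ _)))
  -- normalised bumps at `p` and `q`
  obtain ⟨βp, φp, -, hβp0, hβp1, hβps, hφp, hφpT⟩ := exists_onePoint_bump p hr0 hrp
  obtain ⟨βq, φq, -, hβq0, hβq1, hβqs, hφq, hφqT⟩ := exists_onePoint_bump q hr0 hrq
  -- the Gram data
  obtain ⟨hAim, hAre, hCS⟩ := gram_facts h hφpT hφqT hτ
  obtain ⟨hBim, hBre, -⟩ := gram_facts h hφqT hφqT le_rfl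
  refine ⟨S₁ 2 (SchwartzMap.appendTensor (osAdjoint φp) φp),
    S₁ 2 (SchwartzMap.appendTensor (osAdjoint φq) φq),
    S₁ 2 (SchwartzMap.appendTensor (osAdjoint φp) (translateMulti c φq)),
    hAim, hAre, hBim, hBre, hCS, ?_, ?_, ?_⟩
  · exact norm_osPair_sub_le hrep hrp hrp hβp0 hβp0 hβp1 hβp1 hβps hβps
      (fun z hz => hK₁ z (lt_trans hz hr₁)) (fun y => osPair_apply hφp hφp y)
  · exact norm_osPair_sub_le hrep hrq hrq hβq0 hβq0 hβq1 hβq1 hβqs hβqs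
      (fun z hz => hK₂ z (lt_trans hz hr₂)) (fun y => osPair_apply hφq hφq y)
  · have hφqτ : ∀ w, translateMulti c φq w =
        (((fun z => βq (z - c)) (w 0) : ℝ) : ℂ) := fun w => by
      rw [translateMulti_apply, hφq]
    have hβqτ1 : ∫ z : (EuclideanSpace ℝ (Fin 4)), (fun z => βq (z - c)) z = 1 := by
      rw [integral_sub_right_eq_self (fun z => βq z) c]; exact hβq1
    have hβqτs : ∀ z : (EuclideanSpace ℝ (Fin 4)), (fun z => βq (z - c)) z ≠ 0 →
        dist z (q + c) < r := by
      intro z hz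
      have := hβqs _ hz
      rwa [dist_eq_norm, sub_sub, add_comm, ← dist_eq_norm] at this
    exact norm_osPair_sub_le hrep hrp hrqτ hβp0 (fun z => hβq0 _) hβp1 hβqτ1 hβps hβqτs
      (fun z hz => hK₃ z (lt_trans hz hr₃))
      (fun y => osPair_apply (βb := fun z => βq (z - c)) hφp hφqτ y)

/-! ## From Gram data to kernel inequalities -/

/-- Elementary step: if `A, B ≥ 0` are within `ε` of numbers of real part `k`, `|C|² ≤ A·B` and
`C` is within `ε` of `w`, then `‖w‖ ≤ k + 2ε`. [folklore] -/
theorem norm_le_of_gram_approx {A B C w κ₁ κ₂ : ℂ} {k ε : ℝ}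
    (hA0 : 0 ≤ A.re) (hB0 : 0 ≤ B.re) (hCS : ‖C‖ ^ 2 ≤ A.re * B.re)
    (hA : ‖A - κ₁‖ ≤ ε) (hB : ‖B - κ₂‖ ≤ ε) (hκ₁ : κ₁.re = k) (hκ₂ : κ₂.re = k)
    (hC : ‖C - w‖ ≤ ε) : ‖w‖ ≤ k + 2 * ε := by
  have hA' : A.re ≤ k + ε := by
    have h := (Complex.re_le_norm (A - κ₁)).trans hA
    rw [Complex.sub_re, hκ₁] at h; linarith
  have hB' : B.re ≤ k + ε := by
    have h := (Complex.re_le_norm (B - κ₂)).trans hB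
    rw [Complex.sub_re, hκ₂] at h; linarith
  have hk : 0 ≤ k + ε := hA0.trans hA'
  have hCsq : ‖C‖ ^ 2 ≤ (k + ε) ^ 2 := by
    rw [sq (k + ε)]; exact hCS.trans (mul_le_mul hA' hB' hB0 hk)
  have hCle : ‖C‖ ≤ k + ε := (pow_le_pow_iff_left₀ (norm_nonneg C) hk two_ne_zero).1 hCsq
  have := norm_le_insert C w
  linarith

/-- Kernel points of the diagonal Gram entry: `θ(s/2 · e₀) - s/2 · e₀ = -s e₀`. [folklore] -/
theorem timeReflection_timeVec_half_sub (s : ℝ) :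
    timeReflection 4 (timeVec (s / 2)) - (timeVec (s / 2) : EuclideanSpace ℝ (Fin 4)) =
      EuclideanSpace.single 0 (-s) := by
  ext i
  by_cases hi : i = 0
  · subst hi; simp [timeVec, timeReflection_apply]; ring
  · simp [timeVec, timeReflection_apply, hi]

/-- Kernel point of the shifted Gram entry: `θ(s₁/2 · e₀) - (s₁/2 + (s₂ - s₁)) e₀ = -s₂ e₀`. [folklore] -/
theorem timeReflection_timeVec_half_sub_add (s₁ s₂ : ℝ) :
    timeReflection 4 (timeVec (s₁ / 2)) -
        ((timeVec (s₁ / 2) : EuclideanSpace ℝ (Fin 4)) + timeVec (s₂ - s₁)) =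
      EuclideanSpace.single 0 (-s₂) := by
  ext i
  by_cases hi : i = 0
  · subst hi; simp [timeVec, timeReflection_apply]; ring
  · simp [timeVec, timeReflection_apply, hi]

/-- Kernel points for an off-axis `ξ` with `ξ₀ = -2t`: with `p = t e₀`, `q = -t e₀ - ξ` one has
`θp - p = θq - q = ξ₀ e₀`, `θp - q = ξ`, `q₀ = p₀ = t`. [folklore] -/
theorem gram_points_offaxis (ξ : EuclideanSpace ℝ (Fin 4)) (t : ℝ) (ht : ξ 0 = -(2 * t)) :
    timeReflection 4 (timeVec t) - (timeVec t : EuclideanSpace ℝ (Fin 4)) = EuclideanSpace.single 0 (ξ 0) ∧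
    timeReflection 4 ((timeVec (-t) : EuclideanSpace ℝ (Fin 4)) - ξ) -
        ((timeVec (-t) : EuclideanSpace ℝ (Fin 4)) - ξ) = EuclideanSpace.single 0 (ξ 0) ∧
    timeReflection 4 (timeVec t) - (((timeVec (-t) : EuclideanSpace ℝ (Fin 4)) - ξ) + timeVec 0) = ξ ∧
    ((timeVec (-t) : EuclideanSpace ℝ (Fin 4)) - ξ) 0 = t ∧ (timeVec t : EuclideanSpace ℝ (Fin 4)) 0 = t := by
  refine ⟨?_, ?_, ?_, ?_, ?_⟩
  · ext i
    by_cases hi : i = 0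
    · subst hi; simp [timeVec, timeReflection_apply, ht]; ring
    · simp [timeVec, timeReflection_apply, hi]
  · ext i
    by_cases hi : i = 0
    · subst hi; simp [timeVec, timeReflection_apply, ht]; ring
    · simp [timeVec, timeReflection_apply, hi]
  · ext i
    by_cases hi : i = 0
    · subst hi; simp [timeVec, timeReflection_apply, ht]
    · simp [timeVec, timeReflection_apply, hi]
  · simp [timeVec, ht]; ring
  · simp [timeVec]

/-- **Negative half-space control of the kernel** (the OS form at kernel level). Let `𝔖` satisfy
E2 and translation invariance on `⁰𝒮`, and let `K` (continuous off `0`) represent `𝔖₂` on `⁰𝒮`.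
Then for `s > 0` the axis value `K(-s e₀)` is real and non-negative (`‖Ψ‖² ≥ 0` for bumps
shrinking to `(s/2) e₀`), `s ↦ Re K(-s e₀)` is non-increasing on `(0, ∞)` (contraction property of
`e^{-τH}`), and `‖K ξ‖ ≤ Re K(ξ₀ e₀)` whenever `ξ₀ < 0` (Cauchy–Schwarz for bumps at `t e₀` and
`t e₀ - ξ⃗`, `t = -ξ₀/2`). [folklore] -/
theorem negative_halfspace_control (S₁ : SchwingerFamily (EuclideanSpace ℝ (Fin 4)))
    (K : (EuclideanSpace ℝ (Fin 4)) → ℂ) (hE2 : S₁.toLabelled.IsReflectionPositive)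
    (hT : ∀ (n : ℕ) (a : (EuclideanSpace ℝ (Fin 4))) (F : 𝓢((Fin n → (EuclideanSpace ℝ (Fin 4))), ℂ)),
      IsOffDiagonal F → S₁ n (translateMulti a F) = S₁ n F)
    (hK : ContinuousOn K {x : (EuclideanSpace ℝ (Fin 4)) | x ≠ 0})
    (hrep : ∀ F : 𝓢((Fin 2 → (EuclideanSpace ℝ (Fin 4))), ℂ), IsOffDiagonal F →
      Integrable (fun x : Fin 2 → (EuclideanSpace ℝ (Fin 4)) => K (x 0 - x 1) * F x) ∧
        S₁ 2 F = ∫ x : Fin 2 → (EuclideanSpace ℝ (Fin 4)), K (x 0 - x 1) * F x) :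
    (∀ s : ℝ, 0 < s → (K (EuclideanSpace.single 0 (-s))).im = 0 ∧
      0 ≤ (K (EuclideanSpace.single 0 (-s))).re) ∧
    (∀ s₁ s₂ : ℝ, 0 < s₁ → s₁ ≤ s₂ →
      (K (EuclideanSpace.single 0 (-s₂))).re ≤ (K (EuclideanSpace.single 0 (-s₁))).re) ∧
    (∀ ξ : EuclideanSpace ℝ (Fin 4), ξ 0 < 0 → ‖K ξ‖ ≤ (K (EuclideanSpace.single 0 (ξ 0))).re) := by
  have htv : ∀ t : ℝ, (timeVec t : EuclideanSpace ℝ (Fin 4)) 0 = t :=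
    OSReconstructionNoE1.timeVec_apply_zero
  refine ⟨fun s hs => ?_, fun s₁ s₂ hs₁ hs₁₂ => ?_, fun ξ hξ => ?_⟩
  · -- reality and positivity on the negative axis
    have hp : 0 < (timeVec (s / 2) : EuclideanSpace ℝ (Fin 4)) 0 := by rw [htv]; linarith
    have key : ∀ ε : ℝ, 0 < ε → |(K (EuclideanSpace.single 0 (-s))).im| ≤ ε ∧
        -ε ≤ (K (EuclideanSpace.single 0 (-s))).re := by
      intro ε hε
      obtain ⟨A, -, -, hAim, hAre, -, -, -, hA, -, -⟩ :=
        exists_gram_approx S₁ K hE2 hT hK hrep _ _ hp hp le_rfl hε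
      rw [timeReflection_timeVec_half_sub] at hA
      have him := (Complex.abs_im_le_norm _).trans hA
      have hre := (Complex.abs_re_le_norm _).trans hA
      rw [Complex.sub_im, hAim, zero_sub, abs_neg] at him
      rw [Complex.sub_re, abs_le] at hre
      exact ⟨him, by linarith [hre.2]⟩
    refine ⟨?_, le_of_forall_pos_le_add fun ε hε => by linarith [(key ε hε).2]⟩
    have h0 : |(K (EuclideanSpace.single 0 (-s))).im| ≤ 0 :=
      le_of_forall_pos_le_add fun ε hε => by linarith [(key ε hε).1]
    exact abs_nonpos_iff.1 h0
  · -- monotonicity along the negative axis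
    have hp : 0 < (timeVec (s₁ / 2) : EuclideanSpace ℝ (Fin 4)) 0 := by rw [htv]; linarith
    refine le_of_forall_pos_le_add fun ε hε => ?_
    obtain ⟨A, B, C, -, hAre, -, hBre, hCS, hA, hB, hC⟩ :=
      exists_gram_approx S₁ K hE2 hT hK hrep _ _ hp hp (sub_nonneg.2 hs₁₂) (half_pos hε)
    rw [timeReflection_timeVec_half_sub] at hA hB
    rw [timeReflection_timeVec_half_sub_add] at hC
    have h := norm_le_of_gram_approx hAre hBre hCS hA hB rfl rfl hC
    have := Complex.re_le_norm (K (EuclideanSpace.single 0 (-s₂)))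
    linarith
  · -- off-axis points with negative time
    obtain ⟨e₁, e₂, e₃, hq0, hp0⟩ := gram_points_offaxis ξ (-(ξ 0) / 2) (by ring)
    have ht : 0 < -(ξ 0) / 2 := by linarith
    have hp : 0 < (timeVec (-(ξ 0) / 2) : EuclideanSpace ℝ (Fin 4)) 0 := by rw [hp0]; exact ht
    have hq : 0 < ((timeVec (-(-(ξ 0) / 2)) : EuclideanSpace ℝ (Fin 4)) - ξ) 0 := by rw [hq0]; exact ht
    refine le_of_forall_pos_le_add fun ε hε => ?_
    obtain ⟨A, B, C, -, hAre, -, hBre, hCS, hA, hB, hC⟩ :=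
      exists_gram_approx S₁ K hE2 hT hK hrep _ _ hp hq le_rfl (half_pos hε)
    rw [e₁] at hA
    rw [e₂] at hB
    rw [e₃] at hC
    have h := norm_le_of_gram_approx hAre hBre hCS hA hB rfl rfl hC
    linarith

/-- **Sub-goal `NegativeHalfspaceControl`** (helper for stub `AxisEnvelope`): E2 + translations +
a continuous-off-`0` representing kernel ⇒ `K(-s e₀)` real `≥ 0`, `s ↦ Re K(-s e₀)` non-increasing
on `(0,∞)`, and `‖K ξ‖ ≤ Re K(ξ₀ e₀)` for `ξ₀ < 0`. [folklore] -/
theorem NegativeHalfspaceControl : open Literature.MathematicalPhysics.QuantumLattice Literature.MathematicalPhysics.AQFT in ∀ (S₁ : SchwingerFamily (EuclideanSpace ℝ (Fin 4))) (K : (EuclideanSpace ℝ (Fin 4)) → ℂ), S₁.toLabelled.IsReflectionPositive → (∀ (n : ℕ) (a : (EuclideanSpace ℝ (Fin 4))) (F : SchwartzMap (Fin n → (EuclideanSpace ℝ (Fin 4))) ℂ), IsOffDiagonal F → S₁ n (translateMulti a F) = S₁ n F) → ContinuousOn K {x : (EuclideanSpace ℝ (Fin 4)) | x ≠ 0} →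 (∀ F : SchwartzMap (Fin 2 → (EuclideanSpace ℝ (Fin 4))) ℂ, IsOffDiagonal F → MeasureTheory.Integrable (fun x : Fin 2 → (EuclideanSpace ℝ (Fin 4)) => K (x 0 - x 1) * F x) ∧ S₁ 2 F = ∫ x : Fin 2 → (EuclideanSpace ℝ (Fin 4)), K (x 0 - x 1) * F x) → (∀ s : ℝ, 0 < s → (K (EuclideanSpace.single 0 (-s))).im = 0 ∧ 0 ≤ (K (EuclideanSpace.single 0 (-s))).re) ∧ (∀ s₁ s₂ : ℝ, 0 < s₁ → s₁ ≤ s₂ → (K (EuclideanSpace.single 0 (-s₂))).re ≤ (K (EuclideanSpace.single 0 (-s₁))).re) ∧ (∀ ξ : EuclideanSpace ℝ (Fin 4), ξ 0 < 0 → ‖K ξ‖ ≤ (K (EuclideanSpace.single 0 (ξ 0))).re) := by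
  intro S₁ K hE2 hT hK hrep
  exact negative_halfspace_control S₁ K hE2 hT hK hrep

end Summit.QuantumFields.YangMills.Theorems.CurvatureKernel

end
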